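/-
Copyright: public domain mathematics; formalisation notes by the eng-sdp-4 engines lane (shared numerical
engines serving client cells; rigour lives in the verifiers).
-/
import Literature.MathematicalPhysics.QuantumFieldTheory.O2ExtFormEnclosure
import Literature.MathematicalPhysics.QuantumFieldTheory.ConformalBootstrap3D.BlockPointEnclosureAB
import HarnessLib

/-!
# O(2) `{φ, s, t}` scan: block-value tables of the external channels and their `F`-tables

`O2ExtFormEnclosure` reduces the enclosure of the external forms `α(V⃗_ext)` (Chester et al., Algorithm 1:
`Q_i = α_i(V⃗_ext)`) to `F`-TABLES: per channel label `L` and functional node `m`, two-sided enclosures of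
`F_∓[g_L](u_m, v_m)` valid for EVERY genuine block family `g` of the channel (`FTable`). This file supplies
the `F`-tables from BLOCK-VALUE TABLES and those from finitely many closed-form numbers:

1. **Values of a genuine family at a node** (`IsBlockUV`): `g_L(u_m, v_m)` is the `z`-picture block at
   `(z_m, z̄_m)` and `g_L(v_m, u_m)` the one at the reflected node `(1 − z_m, 1 − z̄_m)`
   (definitionally, resp. `swap_value_eq_pullbackZ`), so BOTH are enclosed by the head ± tail rule
   `ConformalBootstrap3D.IsConformalBlock3D.mem_Icc_hrHeadAB` (`IsBlockUV.mem_Icc_node`,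
   `IsBlockUV.mem_Icc_node_swap`): head `H_N` at the (reflected) node, tail `½(t T_a + t⁻¹ T_b)` from the
   two reflection-positive diagonal tails at a radius `Mp_m ≥ max(z_m, z̄_m)`, resp. `Mm_m ≥ max(1 − z_m, 1 − z̄_m)`.
2. **Block-value tables ⇒ `F`-tables** (`ValTable`, `PowTable`, `fTable_of_valTable`): interval products
   with the power enclosures `v_m^{x_L}`, `u_m^{x_L}` (`O2ExtFormEnclosure.Fm_mem_Icc` / `Fp_mem_Icc`).
3. **Head/tail number tables ⇒ block-value tables** (`HeadTable`, `DiagBoundTable`, `NodeDom`,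
   `RadTable`, `valTable_of_headTable`): per `(m, L)` an enclosure of the head at the node and at the
   reflected node, ONE number `U ≥ D(c; y')` per diagonal parameter `c ∈ {−Δ₁₂(L)/2, Δ₃₄(L)/2}`
   (`blockParA`, `blockParB`) at a common `y' < 1` dominating the nodes, and stated radii above the
   closed-form tail radii `½(t_L (M/y')^{Δ+N+1}(U_a − S_N(a; y')) + t_L⁻¹ (M/y')^{Δ+N+1}(U_b − S_N(b; y')))`
   (`tailRad`, from `ConformalBootstrap3D.diagTailAB_le_of_diagSeriesAB_le`).
4. **Uniformly on a box of external dimensions**: the same with every hypothesis table valid at every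
   `D` of `[lo, hi]` and power bounds at the exponent corners (`PowBoxTable`, `fTable_on_dbox`), and the
   node tables of the three external channels read off their `F`-tables (`nodeTables_on_dbox_of_FTables`)
   — literally the binders `h0/h1/h2` of `O2ExtFormEnclosure.henc_of_nodeTables` / `boxExcluded_of_nodeTables`.

NON-CLAIMS. Soundness lemmas only: no head, tail, power or diagonal bound is evaluated here, no
certificate is checked, nothing is asserted about the O(2) model. The diagonal upper bounds `U ≥ D(c; y')`
(`DiagBoundTable`) are HYPOTHESES and are the only inputs of the chain that are not closed-form checks:
the tree encloses a reflection-positive diagonal series only GIVEN such a number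
(`ConformalBootstrap3D.IsConformalBlock3D.diag_mem_Icc_of_neg_eq`); supplying them is a separate
file's or a verifier's business — at `c = 0` (labels with `Δ₁ = Δ₂`) and exchanged dimension in `(1, 2]`
a closed-form `U` is the Leibniz enclosure of El-Showk et al.'s alternating diagonal series
(`ConformalBootstrap3D.diag_tsum_mem_Icc_of_elShowk`, GIVEN the named fact
`ConformalBootstrap3D.ElShowkDiagonalClosedForm`; El-Showk et al. 2012, App. B); at `c ≠ 0` no closed
form is known ("may be difficult", ibid.) and `U` is validated numerics. The file introduces
`Prop`-valued tables and table-assembling definitions together with their soundness theorems; it is filed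
as kind `definition`.
-/

noncomputable section

namespace Literature.MathematicalPhysics.QuantumFieldTheory.O2ExtBlockTables

open Set Finset Matrix
open Literature.MathematicalPhysics.QuantumFieldTheory.ConformalBootstrap3D
open O2ThreeScalarCrossing O2ThreeScalarSystem O2OPEScanBridge O2ExtFormEnclosure

/-! ## 1. Values of a genuine family at a node and at the reflected node -/

/-- `G((1−z)(1−z̄), z z̄) = (pullbackZ G)(1 − z, 1 − z̄)`: the swapped value is the block at the reflected
node. [cite: ChesterEtAl2020, §2.1 (cross ratios `u, v`; `u ↔ v` under `z → 1 − z`)] -/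
theorem swap_value_eq_pullbackZ (G : ℝ → ℝ → ℝ) (z zb : ℝ) :
    G ((1 - z) * (1 - zb)) (z * zb) = pullbackZ G (1 - z) (1 - zb) := by
  show G _ _ = G _ _
  congr 1; ring

variable {Δ₁₂ Δ₃₄ Δ : ℝ} {ℓ : ℕ} {G : ℝ → ℝ → ℝ}

/-- **Enclosure of `G(u, v)` at a node `(z, z̄) ∈ (0,1)²`** from the head at `(z, z̄)` and tail bounds at
`M ≥ max(z, z̄)`. [cite: DolanOsborn2004, §3 eqs. (3.9)–(3.12)] [cite: ChesterEtAl2020, §3.3 (`Q_i = α_i(V⃗_ext)`)] -/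
theorem IsBlockUV.mem_Icc_node (hΔ : unitarityBound3D ℓ < Δ) (h1 : ℓ = 0 → Δ ≠ 1)
    (h : IsBlockUV Δ₁₂ Δ₃₄ Δ ℓ G) {z zb M t Ta Tb : ℝ} (hz : z ∈ Ioo (0 : ℝ) 1) (hzb : zb ∈ Ioo (0 : ℝ) 1)
    (hzM : z ≤ M) (hzbM : zb ≤ M) (hM1 : M < 1) (ht : 0 < t) (N : ℕ)
    (hTa : diagTailAB (-Δ₁₂ / 2) Δ ℓ N M ≤ Ta) (hTb : diagTailAB (Δ₃₄ / 2) Δ ℓ N M ≤ Tb) :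
    G (z * zb) ((1 - z) * (1 - zb)) ∈
      Icc (hrHeadAB (-Δ₁₂ / 2) (Δ₃₄ / 2) Δ ℓ N z zb - (t * Ta + t⁻¹ * Tb) / 2)
        (hrHeadAB (-Δ₁₂ / 2) (Δ₃₄ / 2) Δ ℓ N z zb + (t * Ta + t⁻¹ * Tb) / 2) :=
  IsConformalBlock3D.mem_Icc_hrHeadAB hΔ h1 h hz hzb hzM hzbM hM1 ht N hTa hTb

/-- **Enclosure of the swapped value `G(v, u)`** from the head at the reflected node `(1 − z, 1 − z̄)` and
tail bounds at `M ≥ max(1 − z, 1 − z̄)`. [cite: DolanOsborn2004, §3 eqs. (3.9)–(3.12)]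
[cite: ChesterEtAl2020, §2.1 (`F^{ij,kl}_{∓}`: the term `u^{…} g(v,u)`)] -/
theorem IsBlockUV.mem_Icc_node_swap (hΔ : unitarityBound3D ℓ < Δ) (h1 : ℓ = 0 → Δ ≠ 1)
    (h : IsBlockUV Δ₁₂ Δ₃₄ Δ ℓ G) {z zb M t Ta Tb : ℝ} (hz : z ∈ Ioo (0 : ℝ) 1) (hzb : zb ∈ Ioo (0 : ℝ) 1)
    (hzM : 1 - z ≤ M) (hzbM : 1 - zb ≤ M) (hM1 : M < 1) (ht : 0 < t) (N : ℕ)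
    (hTa : diagTailAB (-Δ₁₂ / 2) Δ ℓ N M ≤ Ta) (hTb : diagTailAB (Δ₃₄ / 2) Δ ℓ N M ≤ Tb) :
    G ((1 - z) * (1 - zb)) (z * zb) ∈
      Icc (hrHeadAB (-Δ₁₂ / 2) (Δ₃₄ / 2) Δ ℓ N (1 - z) (1 - zb) - (t * Ta + t⁻¹ * Tb) / 2)
        (hrHeadAB (-Δ₁₂ / 2) (Δ₃₄ / 2) Δ ℓ N (1 - z) (1 - zb) + (t * Ta + t⁻¹ * Tb) / 2) := by
  rw [swap_value_eq_pullbackZ G z zb]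
  have hz' : 1 - z ∈ Ioo (0 : ℝ) 1 := ⟨by linarith [hz.2], by linarith [hz.1]⟩
  have hzb' : 1 - zb ∈ Ioo (0 : ℝ) 1 := ⟨by linarith [hzb.2], by linarith [hzb.1]⟩
  exact IsConformalBlock3D.mem_Icc_hrHeadAB hΔ h1 h hz' hzb' hzM hzbM hM1 ht N hTa hTb

/-! ## 2. Block-value tables and power tables ⇒ `F`-tables -/

/-- **BLOCK-VALUE TABLE** of a channel at `(D, S, Δ)`: for every block family genuine at `(Δ, 0)` on `S`,
every node `m` and label `L ∈ S`, `g_L(u_m, v_m) ∈ [Vlo, Vhi]` and `g_L(v_m, u_m) ∈ [Wlo, Whi]`.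
[cite: ChesterEtAl2020, §2.1 (`F^{ij,kl}_{∓,Δ,ℓ}`), §3.3 (`Q_i = α_i(V⃗_ext)`)] -/
def ValTable (F : ScanFunctional) (D : Dims) (S : List Label) (Δ : ℝ)
    (Vlo Vhi Wlo Whi : Fin F.M → Label → ℝ) : Prop :=
  ∀ g : Label → ℝ → ℝ → ℝ, GenuineOn D S Δ 0 g → ∀ m, ∀ L ∈ S,
    g L (F.u m) (F.v m) ∈ Icc (Vlo m L) (Vhi m L) ∧ g L (F.v m) (F.u m) ∈ Icc (Wlo m L) (Whi m L)

/-- **POWER TABLE** at `D`: `v_m^{x_L} ∈ [P₁, P₂]`, `u_m^{x_L} ∈ [Q₁, Q₂]` with `0 ≤ P₁, Q₁`, `x_L = D.expo L`.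
[cite: ChesterEtAl2020, §2.1 (exponents `(Δ_k+Δ_j)/2`)] [cite: Moore1979, §2.2 eq. (2.19) (interval product)] -/
def PowTable (F : ScanFunctional) (D : Dims) (S : List Label) (P₁ P₂ Q₁ Q₂ : Fin F.M → Label → ℝ) : Prop :=
  ∀ m, ∀ L ∈ S, (F.v m ^ D.expo L ∈ Icc (P₁ m L) (P₂ m L) ∧ 0 ≤ P₁ m L) ∧
    (F.u m ^ D.expo L ∈ Icc (Q₁ m L) (Q₂ m L) ∧ 0 ≤ Q₁ m L)

/-- **Power table on a box of external dimensions** from rational bounds at the box's exponent corners: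
`0 ≤ P₁ ≤ v_m^{hi.expo L}`, `v_m^{lo.expo L} ≤ P₂` (and the same for `u_m`) give a power table at every
`D` of the box (`t ↦ t^x` is antitone in `x` for `t ∈ (0, 1)`). [cite: ChesterEtAl2020, §3.3 (scanning over external dimensions)]
[cite: Moore1979, §2.2 eq. (2.19), §2.4 (outward rounding)] -/
def PowBoxTable (F : ScanFunctional) (lo hi : Dims) (S : List Label)
    (P₁ P₂ Q₁ Q₂ : Fin F.M → Label → ℝ) : Prop :=
  ∀ m, ∀ L ∈ S, (0 ≤ P₁ m L ∧ P₁ m L ≤ F.v m ^ hi.expo L ∧ F.v m ^ lo.expo L ≤ P₂ m L) ∧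
    (0 ≤ Q₁ m L ∧ Q₁ m L ≤ F.u m ^ hi.expo L ∧ F.u m ^ lo.expo L ≤ Q₂ m L)

/-- A power table on the box is a power table at every `D` of the box.
[cite: ChesterEtAl2020, §3.3 (scanning over external dimensions)] -/
theorem powTable_of_powBoxTable (F : ScanFunctional) {lo hi D : Dims} {S : List Label}
    {P₁ P₂ Q₁ Q₂ : Fin F.M → Label → ℝ} (hD : O2DimBox.InDimBox lo hi D)
    (h : PowBoxTable F lo hi S P₁ P₂ Q₁ Q₂) : PowTable F D S P₁ P₂ Q₁ Q₂ := by
  intro m L hL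
  obtain ⟨⟨hp0, hp1, hp2⟩, ⟨hq0, hq1, hq2⟩⟩ := h m L hL
  have hx := O2DimBox.expo_mem_Icc hD L
  have hv := rpow_mem_Icc_of_expo (v_mem_Ioo F m).1 (v_mem_Ioo F m).2.le hx
  have hu := rpow_mem_Icc_of_expo (u_mem_Ioo F m).1 (u_mem_Ioo F m).2.le hx
  exact ⟨⟨⟨hp1.trans hv.1, hv.2.trans hp2⟩, hp0⟩, ⟨⟨hq1.trans hu.1, hu.2.trans hq2⟩, hq0⟩⟩

/-- Lower `F_−` entry assembled from value and power tables. [cite: Moore1979, §2.2 eqs. (2.15), (2.19)] -/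
def fAm {M : ℕ} (P₁ P₂ Q₁ Q₂ Vlo Whi : Fin M → Label → ℝ) : Fin M → Label → ℝ :=
  fun m L => min (P₁ m L * Vlo m L) (P₂ m L * Vlo m L) - max (Q₁ m L * Whi m L) (Q₂ m L * Whi m L)

/-- Upper `F_−` entry. [cite: Moore1979, §2.2 eqs. (2.15), (2.19)] -/
def fBm {M : ℕ} (P₁ P₂ Q₁ Q₂ Vhi Wlo : Fin M → Label → ℝ) : Fin M → Label → ℝ :=
  fun m L => max (P₁ m L * Vhi m L) (P₂ m L * Vhi m L) - min (Q₁ m L * Wlo m L) (Q₂ m L * Wlo m L)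

/-- Lower `F_+` entry. [cite: Moore1979, §2.2 eqs. (2.14), (2.19)] -/
def fAp {M : ℕ} (P₁ P₂ Q₁ Q₂ Vlo Wlo : Fin M → Label → ℝ) : Fin M → Label → ℝ :=
  fun m L => min (P₁ m L * Vlo m L) (P₂ m L * Vlo m L) + min (Q₁ m L * Wlo m L) (Q₂ m L * Wlo m L)

/-- Upper `F_+` entry. [cite: Moore1979, §2.2 eqs. (2.14), (2.19)] -/
def fBp {M : ℕ} (P₁ P₂ Q₁ Q₂ Vhi Whi : Fin M → Label → ℝ) : Fin M → Label → ℝ :=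
  fun m L => max (P₁ m L * Vhi m L) (P₂ m L * Vhi m L) + max (Q₁ m L * Whi m L) (Q₂ m L * Whi m L)

/-- **Block-value table + power table ⇒ `F`-table** (the input of `O2ExtFormEnclosure.nodeTable*_of_FTable`
and `extEnclosed_of_FTables`). [cite: ChesterEtAl2020, §2.1 (`F^{ij,kl}_{∓,Δ,ℓ}`), §3.3 (Algorithm 1)]
[cite: Moore1979, §2.2 eqs. (2.14), (2.15), (2.19) (interval arithmetic)] -/
theorem fTable_of_valTable (F : ScanFunctional) {D : Dims} {S : List Label} {Δ : ℝ}
    {Vlo Vhi Wlo Whi P₁ P₂ Q₁ Q₂ : Fin F.M → Label → ℝ} (hV : ValTable F D S Δ Vlo Vhi Wlo Whi)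
    (hP : PowTable F D S P₁ P₂ Q₁ Q₂) :
    FTable F D S Δ (fAm P₁ P₂ Q₁ Q₂ Vlo Whi) (fBm P₁ P₂ Q₁ Q₂ Vhi Wlo)
      (fAp P₁ P₂ Q₁ Q₂ Vlo Wlo) (fBp P₁ P₂ Q₁ Q₂ Vhi Whi) := by
  intro g hg m L hL
  obtain ⟨hguv, hgvu⟩ := hV g hg m L hL
  obtain ⟨⟨hv, hp⟩, ⟨hu, hq⟩⟩ := hP m L hL
  exact ⟨Fm_mem_Icc hguv hgvu hv hu hp hq, Fp_mem_Icc hguv hgvu hv hu hp hq⟩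

/-! ## 3. Head tables, diagonal bounds and node radii ⇒ block-value tables -/

/-- The first block parameter `a_L = −Δ_ij(L)/2` of the label `L`. [cite: DolanOsborn2004, §3 eq. (3.11)] -/
def blockParA (D : Dims) (L : Label) : ℝ := -d12 D L / 2

/-- The second block parameter `b_L = Δ_kl(L)/2` of the label `L`. [cite: DolanOsborn2004, §3 eq. (3.11)] -/
def blockParB (D : Dims) (L : Label) : ℝ := d34 D L / 2

/-- **HEAD TABLE**: per node `m` and label `L ∈ S`, enclosures of the level-`≤ N` head `H_N(a_L, b_L; ·)` at the
node `(z_m, z̄_m)` (`[Hlo, Hhi]`) and at the reflected node `(1 − z_m, 1 − z̄_m)` (`[Klo, Khi]`) — finite sums,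
closed form in `D`. [cite: DolanOsborn2004, §3 eq. (3.10)] [cite: ChesterEtAl2020, §3.3 (`Q_i = α_i(V⃗_ext)`)] -/
def HeadTable (F : ScanFunctional) (D : Dims) (S : List Label) (Δ : ℝ) (N : ℕ)
    (Hlo Hhi Klo Khi : Fin F.M → Label → ℝ) : Prop :=
  ∀ m, ∀ L ∈ S,
    hrHeadAB (blockParA D L) (blockParB D L) Δ 0 N (F.z m) (F.zb m) ∈ Icc (Hlo m L) (Hhi m L) ∧
      hrHeadAB (blockParA D L) (blockParB D L) Δ 0 N (1 - F.z m) (1 - F.zb m) ∈ Icc (Klo m L) (Khi m L)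

/-- **DIAGONAL BOUND TABLE**: ONE number per diagonal parameter, `D(a_L; y') ≤ Ua L` and `D(b_L; y') ≤ Ub L`
(the reflection-positive diagonal series `ConformalBootstrap3D.diagSeriesAB` at a common `y'`). These are
the only non-closed-form inputs. [cite: DolanOsborn2004, §3 eq. (3.11)] -/
def DiagBoundTable (D : Dims) (S : List Label) (Δ y' : ℝ) (Ua Ub : Label → ℝ) : Prop :=
  ∀ L ∈ S, diagSeriesAB (blockParA D L) Δ 0 y' ≤ Ua L ∧ diagSeriesAB (blockParB D L) Δ 0 y' ≤ Ub L

/-- **NODE DOMINATION**: `Mp m ≥ max(z_m, z̄_m)`, `Mm m ≥ max(1 − z_m, 1 − z̄_m)`, both `≤ y' < 1`.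
[cite: KosPolandSimmonsduffin2014, §3.1 eq. (3.8) (evaluation points)] -/
def NodeDom (F : ScanFunctional) (y' : ℝ) (Mp Mm : Fin F.M → ℝ) : Prop :=
  ∀ m, (F.z m ≤ Mp m ∧ F.zb m ≤ Mp m ∧ Mp m ≤ y') ∧ (1 - F.z m ≤ Mm m ∧ 1 - F.zb m ≤ Mm m ∧ Mm m ≤ y')

/-- The closed-form TAIL RADIUS at domination radius `M`:
`½ (t_L (M/y')^{Δ+N+1} (Ua L − S_N(a_L; y')) + t_L⁻¹ (M/y')^{Δ+N+1} (Ub L − S_N(b_L; y')))`.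
[cite: DolanOsborn2004, §3 eqs. (3.10)–(3.11)] -/
def tailRad (D : Dims) (Δ : ℝ) (N : ℕ) (y' : ℝ) (t Ua Ub : Label → ℝ) (M : ℝ) (L : Label) : ℝ :=
  (t L * ((M / y') ^ (Δ + N + 1) * (Ua L - hrDiagPartialSumAB (blockParA D L) (blockParA D L) Δ 0 N y')) +
    (t L)⁻¹ * ((M / y') ^ (Δ + N + 1) * (Ub L - hrDiagPartialSumAB (blockParB D L) (blockParB D L) Δ 0 N y'))) / 2

/-- **RADIUS TABLE**: stated radii `Rp m L ≥ tailRad(Mp m)`, `Rm m L ≥ tailRad(Mm m)` (closed-form checks).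
[cite: Moore1979, §2.4 (outward rounding)] -/
def RadTable (F : ScanFunctional) (D : Dims) (S : List Label) (Δ : ℝ) (N : ℕ) (y' : ℝ)
    (t Ua Ub : Label → ℝ) (Mp Mm : Fin F.M → ℝ) (Rp Rm : Fin F.M → Label → ℝ) : Prop :=
  ∀ m, ∀ L ∈ S, tailRad D Δ N y' t Ua Ub (Mp m) L ≤ Rp m L ∧ tailRad D Δ N y' t Ua Ub (Mm m) L ≤ Rm m L

/-- **Head table + diagonal bounds + node domination + radius table ⇒ block-value table** at one `D`
(channel dimension `Δ` strictly above the scalar unitarity bound and `≠ 1`, weights `t_L > 0`).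
[cite: DolanOsborn2004, §3 eqs. (3.9)–(3.12)] [cite: ChesterEtAl2020, §3.3 (Algorithm 1: `Q_i = α_i(V⃗_ext)`)]
[cite: Moore1979, §2.2 eqs. (2.14), (2.19), §2.4] -/
theorem valTable_of_headTable (F : ScanFunctional) {D : Dims} {S : List Label} {Δ y' : ℝ} {N : ℕ}
    {t Ua Ub : Label → ℝ} {Mp Mm : Fin F.M → ℝ} {Hlo Hhi Klo Khi Rp Rm : Fin F.M → Label → ℝ}
    (hΔ : unitarityBound3D 0 < Δ) (h1 : Δ ≠ 1) (ht : ∀ L, 0 < t L) (hy' : y' < 1)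
    (hH : HeadTable F D S Δ N Hlo Hhi Klo Khi) (hU : DiagBoundTable D S Δ y' Ua Ub)
    (hdom : NodeDom F y' Mp Mm) (hR : RadTable F D S Δ N y' t Ua Ub Mp Mm Rp Rm) :
    ValTable F D S Δ (fun m L => Hlo m L - Rp m L) (fun m L => Hhi m L + Rp m L)
      (fun m L => Klo m L - Rm m L) (fun m L => Khi m L + Rm m L) := by
  intro g hg m L hL
  have hb : IsBlockUV (d12 D L) (d34 D L) Δ 0 (g L) := hg L hL
  obtain ⟨⟨hzp, hzbp, hpy⟩, ⟨hzm, hzbm, hmy⟩⟩ := hdom m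
  obtain ⟨hUa, hUb⟩ := hU L hL
  obtain ⟨hHn, hHr⟩ := hH m L hL
  obtain ⟨hRp, hRm⟩ := hR m L hL
  have hz := F.hz m
  have hzb := F.hzb m
  have hMp0 : 0 < Mp m := hz.1.trans_le hzp
  have hMm0 : 0 < Mm m := by linarith [hz.2]
  have hMp1 : Mp m < 1 := lt_of_le_of_lt hpy hy'
  have hMm1 : Mm m < 1 := lt_of_le_of_lt hmy hy'
  have h10 : (0 : ℕ) = 0 → Δ ≠ 1 := fun _ => h1
  -- tail bounds at the two domination radii, from the ONE number per diagonal series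
  have hTa := diagTailAB_le_of_diagSeriesAB_le (blockParA D L) (ℓ := 0) hΔ hMp0 hpy hy' N hUa
  have hTb := diagTailAB_le_of_diagSeriesAB_le (blockParB D L) (ℓ := 0) hΔ hMp0 hpy hy' N hUb
  have hTa' := diagTailAB_le_of_diagSeriesAB_le (blockParA D L) (ℓ := 0) hΔ hMm0 hmy hy' N hUa
  have hTb' := diagTailAB_le_of_diagSeriesAB_le (blockParB D L) (ℓ := 0) hΔ hMm0 hmy hy' N hUb
  have hv := IsBlockUV.mem_Icc_node hΔ h10 hb hz hzb hzp hzbp hMp1 (ht L) N hTa hTb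
  have hw := IsBlockUV.mem_Icc_node_swap hΔ h10 hb hz hzb hzm hzbm hMm1 (ht L) N hTa' hTb'
  -- the same enclosures, restated through the definitional abbreviations `blockParA/blockParB/tailRad/u/v`
  have hv' : g L (F.u m) (F.v m) ∈
      Icc (hrHeadAB (blockParA D L) (blockParB D L) Δ 0 N (F.z m) (F.zb m) - tailRad D Δ N y' t Ua Ub (Mp m) L)
        (hrHeadAB (blockParA D L) (blockParB D L) Δ 0 N (F.z m) (F.zb m) + tailRad D Δ N y' t Ua Ub (Mp m) L) := hv
  have hw' : g L (F.v m) (F.u m) ∈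
      Icc (hrHeadAB (blockParA D L) (blockParB D L) Δ 0 N (1 - F.z m) (1 - F.zb m) - tailRad D Δ N y' t Ua Ub (Mm m) L)
        (hrHeadAB (blockParA D L) (blockParB D L) Δ 0 N (1 - F.z m) (1 - F.zb m) + tailRad D Δ N y' t Ua Ub (Mm m) L) :=
    hw
  show g L (F.u m) (F.v m) ∈ Icc (Hlo m L - Rp m L) (Hhi m L + Rp m L) ∧
    g L (F.v m) (F.u m) ∈ Icc (Klo m L - Rm m L) (Khi m L + Rm m L)
  exact ⟨⟨by linarith [hv'.1, hHn.1], by linarith [hv'.2, hHn.2]⟩,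
    ⟨by linarith [hw'.1, hHr.1], by linarith [hw'.2, hHr.2]⟩⟩

/-! ## 4. Uniformly on a box of external dimensions -/

/-- **`F`-table at every `D` of a dimension box from `D`-uniform tables.** The channel dimension is a
function `Δc` of `D` (`fun D => D.Δs`, `D.Δφ` or `D.Δt` for the three external channels), strictly above the
scalar unitarity bound and `≠ 1` on the box; the head, diagonal-bound and radius tables hold at every `D` of
the box with the SAME numbers (closed-form checks uniform in `D`, except the diagonal bounds); the power
bounds sit at the exponent corners (`PowBoxTable`). The conclusion is, for each `D` of the box, the input of
`O2ExtFormEnclosure.nodeTable0p_of_FTable` / `nodeTable1_of_FTable` / `nodeTable2p_of_FTable`, i.e. of the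
binders `h0/h1/h2` of `O2ExtFormEnclosure.henc_of_nodeTables` and `boxExcluded_of_nodeTables`.
[cite: ChesterEtAl2020, §3.3 (Algorithm 1: `Q_i = α_i(V⃗_ext)`; scanning over external dimensions)]
[cite: DolanOsborn2004, §3 eqs. (3.9)–(3.12)] [cite: Moore1979, §2.2 eqs. (2.14), (2.15), (2.19), §2.4] -/
theorem fTable_on_dbox (F : ScanFunctional) {lo hi : Dims} {S : List Label} {Δc : Dims → ℝ}
    {y' : ℝ} {N : ℕ} {t Ua Ub : Label → ℝ} {Mp Mm : Fin F.M → ℝ}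
    {Hlo Hhi Klo Khi Rp Rm P₁ P₂ Q₁ Q₂ : Fin F.M → Label → ℝ}
    (hΔ : ∀ D, O2DimBox.InDimBox lo hi D → unitarityBound3D 0 < Δc D ∧ Δc D ≠ 1)
    (ht : ∀ L, 0 < t L) (hy' : y' < 1) (hdom : NodeDom F y' Mp Mm)
    (hH : ∀ D, O2DimBox.InDimBox lo hi D → HeadTable F D S (Δc D) N Hlo Hhi Klo Khi)
    (hU : ∀ D, O2DimBox.InDimBox lo hi D → DiagBoundTable D S (Δc D) y' Ua Ub)
    (hR : ∀ D, O2DimBox.InDimBox lo hi D → RadTable F D S (Δc D) N y' t Ua Ub Mp Mm Rp Rm)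
    (hP : PowBoxTable F lo hi S P₁ P₂ Q₁ Q₂) :
    ∀ D, O2DimBox.InDimBox lo hi D →
      FTable F D S (Δc D)
        (fAm P₁ P₂ Q₁ Q₂ (fun m L => Hlo m L - Rp m L) (fun m L => Khi m L + Rm m L))
        (fBm P₁ P₂ Q₁ Q₂ (fun m L => Hhi m L + Rp m L) (fun m L => Klo m L - Rm m L))
        (fAp P₁ P₂ Q₁ Q₂ (fun m L => Hlo m L - Rp m L) (fun m L => Klo m L - Rm m L))
        (fBp P₁ P₂ Q₁ Q₂ (fun m L => Hhi m L + Rp m L) (fun m L => Khi m L + Rm m L)) :=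
  fun D hD =>
    fTable_of_valTable F
      (valTable_of_headTable F (hΔ D hD).1 (hΔ D hD).2 ht hy' (hH D hD) (hU D hD) hdom (hR D hD))
      (powTable_of_powBoxTable F hD hP)

/-- **Node tables of the three external channels on a box, from their `F`-tables** — literally the binders
`h0`, `h1`, `h2` of `O2ExtFormEnclosure.henc_of_nodeTables` / `boxExcluded_of_nodeTables` for ONE functional,
with the node tables READ OFF the `F`-tables by the fixed row decodings.
[cite: ChesterEtAl2020, §3.3 (Algorithm 1), App. «Crossing vectors»] [cite: Moore1979, §2.2 eqs. (2.14), (2.15), (2.19)] -/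
theorem nodeTables_on_dbox_of_FTables (F : ScanFunctional) {lo hi : Dims}
    {Am₀ Bm₀ Ap₀ Bp₀ Am₁ Bm₁ Ap₁ Bp₁ Am₂ Bm₂ Ap₂ Bp₂ : Fin F.M → Label → ℝ}
    (h0 : ∀ D, O2DimBox.InDimBox lo hi D → FTable F D labels0p D.Δs Am₀ Bm₀ Ap₀ Bp₀)
    (h1 : ∀ D, O2DimBox.InDimBox lo hi D → FTable F D labels1 D.Δφ Am₁ Bm₁ Ap₁ Bp₁)
    (h2 : ∀ D, O2DimBox.InDimBox lo hi D → FTable F D labels2p D.Δt Am₂ Bm₂ Ap₂ Bp₂) :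
    (∀ D, O2DimBox.InDimBox lo hi D → NodeTable F D labels0p D.Δs V0p
        (compLo coefM0p coefP0p rowLab0p Am₀ Bm₀ Ap₀ Bp₀) (compHi coefM0p coefP0p rowLab0p Am₀ Bm₀ Ap₀ Bp₀)) ∧
    (∀ D, O2DimBox.InDimBox lo hi D → NodeTable F D labels1 D.Δφ (fun D' g => V1 D' 1 g)
        (compLo coefM1 coefP1 rowLab1 Am₁ Bm₁ Ap₁ Bp₁) (compHi coefM1 coefP1 rowLab1 Am₁ Bm₁ Ap₁ Bp₁)) ∧
    (∀ D, O2DimBox.InDimBox lo hi D → NodeTable F D labels2p D.Δt V2p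
        (compLo coefM2p coefP2p rowLab2p Am₂ Bm₂ Ap₂ Bp₂) (compHi coefM2p coefP2p rowLab2p Am₂ Bm₂ Ap₂ Bp₂)) :=
  ⟨fun D hD => nodeTable0p_of_FTable F D (h0 D hD), fun D hD => nodeTable1_of_FTable F D (h1 D hD),
    fun D hD => nodeTable2p_of_FTable F D (h2 D hD)⟩

end Literature.MathematicalPhysics.QuantumFieldTheory.O2ExtBlockTables

end
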